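import Summits.BirchSwinnertonDyer.BirchSwinnertonDyer.Theorems.AlignedTransportAtTwoMainConjectureOfRankZeroBSDAtTwoMuNecessity
import Summits.BirchSwinnertonDyer.BirchSwinnertonDyer.Theorems.AlignedTransportAtTwoMainConjectureOfRankZeroBSDAtTwoFineRoadOddIsogeny
import Summits.BirchSwinnertonDyer.BirchSwinnertonDyer.Theorems.AlignedTransportAtTwoMainConjectureOfRankZeroBSDAtTwoFineRoadDivisionCubic
import HarnessLib

/-!
# NECESSITY SPREAD: on the `Δ_W < 0` half of the seed cell, MC₂(W) — hence the crux C2 with BSD₂(W) — forces (A)₂^{rel ∞} for EVERY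
# elliptic curve over `ℚ` sharing the Galois module `W[2]`: all models of all quadratic twists, all odd-isogenous curves, every curve whose
# `2`-division cubic has the same splitting field

Cell `bsd-f1-sign2`, WIDTH-5 attach seat `bsd-line-att-p5` (gen 6) on line `birth` of crux C2
stmt-BirchSwinnertonDyer-22298 `MainConjectureOfRankZeroBSDAtTwo`; composes the lead's NECESSITY file `…MuNecessity`
(`finite_twoTorsion_fineSelmer_of_mazurMainConjecture_two`: PRINT + MC₂(W) + `μ(L₂) = 0` ⟹ statement (A) at `(W, 2)`, door-free) with
att-p4 g3's `RelaxedRestrict.fineSelmerInftyRelaxedInf_eq_of_Δ_neg` (relaxed = strict for `Δ_W < 0`) and the att-p5 rigidity files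
(`…RelaxedCongruence`, `…DivisionFieldRigidity`, `…QuadraticTwist`, `…DivisionCubic`, `…OddIsogeny`). A `--supports 22298 --as helper`
file. HONEST FRAMING: THEOREMS ONLY — no definition, no named fact of mine, no `sorry`; every statement is CONDITIONAL on the displayed
PRINT facts (`hper` period unit at `2`, `hmod` modularity) and on MC₂(W) resp. the crux `hC2`; C2-neutral (closes nothing); BSD is NOT
proved by any of this.

WHAT (all for a seed-cell-shaped `W`: globally minimal, good ordinary at `2`, no rational `2`-torsion, analytic `μ₂ = 0`, and HERE
`Δ_W < 0`; conclusion for every normalised cyclotomic datum `(κ, γ)`):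
* §1 `finite_twoTorsion_relaxed_of_mazurMainConjecture_two_of_torsionIso` — MC₂(W) ⟹ (A)₂^{rel ∞}(W′) for every elliptic `W′/ℚ` with
  `W[2] ≅ W′[2]` `Γ_ℚ`-equivariantly; corollaries for `W′.divisionField 2 = W.divisionField 2`, for models of quadratic twists
  (`C • W′ = W.quadraticTwist d`), for odd-degree isogenies `W → W′`, and for equal splitting fields of the `2`-division cubics.
* §2 the same FROM THE CRUX BY NAME (`hC2 : MainConjectureOfRankZeroBSDAtTwo`, plus `¬CM`, `r_an = 0`, `Δ ∉ ℚ²`, `BSDp W 2`).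
So the ∀-`W` crux AS FILED contains statement (A)₂^{rel ∞} — finiteness of the `2`-torsion of the relaxed-at-`∞` fine Selmer group over
`ℚ_∞` — for every elliptic curve over `ℚ` (ANY rank, ANY reduction at `2`) lying in the `E[2]`-class of a `Δ < 0` seed-cell curve with
BSD₂: a further widening of the lead's reading «C2 contains Iwasawa's `μ₂`-conjecture for the sextics of the cell» (p607593), door-free
and in Selmer currency.

References: R. Greenberg, V. Vatsal, Invent. Math. 142 (2000) p. 2 (2), p. 4; J. Coates, R. Sujatha, Math. Ann. 331 (2005) §3;
M. F. Lim, R. Sujatha, J. Number Theory 187 (2018) §3 Prop. 3.2; J. H. Silverman, *AEC* (2009) X.5 Cor. 5.4, III.4, VIII.§1; the lead's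
PERFECT-DESCENT.md §1 Corollary (necessity) and CENSUS-lead-g6.md (crux workfiles, cell bsd-f1-sign2).
-/

set_option linter.dupNamespace false
set_option autoImplicit false

noncomputable section

open scoped Classical

open CongruenceSubgroup WeierstrassCurve Field Literature.NumberTheory.EllipticCurves
  Literature.NumberTheory.EllipticCurves.ModularForms
  Literature.NumberTheory.EllipticCurves.Rank1Residual
  Literature.NumberTheory.EllipticCurves.Greenberg1999
  Literature.NumberTheory.EllipticCurves.IwasawaModuleFinitePadicInt
  Literature.NumberTheory.IwasawaTheory
  Summit.BirchSwinnertonDyer.Rank1Residual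
  Summit.BirchSwinnertonDyer.Rank1Residual.X1.MuLambda
  Summit.BirchSwinnertonDyer.Rank1Residual.X5
  Summit.BirchSwinnertonDyer.Rank1Residual.F1Sign2
  Summit.BirchSwinnertonDyer.BirchSwinnertonDyer.Theorems.Rank1ResidualX1Defs
  Summit.BirchSwinnertonDyer.BirchSwinnertonDyer.Theses.AlignedTransportAtTwo
  Summit.BirchSwinnertonDyer.BirchSwinnertonDyer.Theorems.AlignedTransportAtTwoMuNecessity
  Summit.BirchSwinnertonDyer.BirchSwinnertonDyer.Theorems.AlignedTransportAtTwoFineRoad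

namespace Summit.BirchSwinnertonDyer.BirchSwinnertonDyer.Theorems.AlignedTransportAtTwoFineRoad.NecessitySpread

variable (W : WeierstrassCurve ℚ) [W.IsElliptic] [W.IsGloballyMinimal] (W' : WeierstrassCurve ℚ) [W'.IsElliptic]

/-! ## §1 From MC₂(W), `Δ_W < 0` -/

/-- **MC₂(W) on the `Δ_W < 0` half-cell ⟹ (A)₂^{rel ∞}(W′) for every `W′/ℚ` with `W[2] ≅ W′[2]` equivariantly** (PRINT: `hper`,
`hmod`; cell binders `hord`, `ht`, `hμan`): necessity (`…MuNecessity.finite_twoTorsion_fineSelmer_of_mazurMainConjecture_two`) gives the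
strict (A)₂(W), which for `Δ_W < 0` is the relaxed one (`RelaxedRestrict.fineSelmerInftyRelaxedInf_eq_of_Δ_neg`), an invariant of the
module `W[2]` (`RelaxedCongruence.finite_twoTorsion_relaxed_iff_of_torsionIso`). Conditional on MC₂(W); nothing else asserted.
[cite: GreenbergVatsal2000, p. 2 (2) and p. 4] [cite: LimSujatha2018, §3 Prop. 3.2] -/
theorem finite_twoTorsion_relaxed_of_mazurMainConjecture_two_of_torsionIso
    (hper : realPeriodRat_eq_unit_mul_plusPeriod_two) (hmod : nonempty_modularParametrizationData) (hord : IsOrdinaryAt W 2)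
    (ht : ∀ x : ℚ, ¬ HasRationalTwoTorsionX W x)
    (hμan : ∀ ⦃N : ℕ⦄ [NeZero N] (f : CuspForm (Gamma0 N) 2), IsNewformOf W f →
      ∀ G : IwasawaAlgebra 2, IsEvenBranchLiftAtTwo W f G → red G ≠ 0)
    (hMC : MazurMainConjecture W 2) (hΔ : W.Δ < 0)
    (e : W.geomTorsion 2 ≃+ W'.geomTorsion 2) (he : ∀ (σ : absoluteGaloisGroup ℚ) (P : W.geomTorsion 2), e (σ • P) = σ • e P) :
    ∀ (κ : ZpExtension ℚ 2) (γ : absoluteGaloisGroup ℚ), κ.IsCyclotomic → κ.IsTopGenerator γ → IsCyclotomicVariable 2 γ →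
      Set.Finite {s : W'.fineSelmerInftyRelaxedInf κ | 2 • s = 0} := by
  intro κ γ hκ hγ hγ'
  have hA : Set.Finite {s : W.fineSelmerInfty κ | 2 • s = 0} :=
    finite_twoTorsion_fineSelmer_of_mazurMainConjecture_two W hper hmod hord ht hμan hMC κ γ hκ hγ hγ'
  have hArel : Set.Finite {s : W.fineSelmerInftyRelaxedInf κ | 2 • s = 0} :=
    (RelaxedCoefficientsRatTwo.finite_nsmul_eq_zero_iff_of_eq (RelaxedRestrict.fineSelmerInftyRelaxedInf_eq_of_Δ_neg W κ hΔ) 2).mpr hA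
  exact (RelaxedCongruence.finite_twoTorsion_relaxed_iff_of_torsionIso W W' κ hκ e he).mp hArel

/-- **MC₂(W), `Δ_W < 0` ⟹ (A)₂^{rel ∞}(W′) whenever `ℚ(W′[2]) = ℚ(W[2])`** (att-p5 g5 `DivisionFieldRigidity`).
[cite: Serre1972, §5.3] [cite: LimSujatha2018, §3 Prop. 3.2] -/
theorem finite_twoTorsion_relaxed_of_mazurMainConjecture_two_of_divisionField_eq
    (hper : realPeriodRat_eq_unit_mul_plusPeriod_two) (hmod : nonempty_modularParametrizationData) (hord : IsOrdinaryAt W 2)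
    (ht : ∀ x : ℚ, ¬ HasRationalTwoTorsionX W x)
    (hμan : ∀ ⦃N : ℕ⦄ [NeZero N] (f : CuspForm (Gamma0 N) 2), IsNewformOf W f →
      ∀ G : IwasawaAlgebra 2, IsEvenBranchLiftAtTwo W f G → red G ≠ 0)
    (hMC : MazurMainConjecture W 2) (hΔ : W.Δ < 0) (hdiv : W.divisionField 2 = W'.divisionField 2) :
    ∀ (κ : ZpExtension ℚ 2) (γ : absoluteGaloisGroup ℚ), κ.IsCyclotomic → κ.IsTopGenerator γ → IsCyclotomicVariable 2 γ →
      Set.Finite {s : W'.fineSelmerInftyRelaxedInf κ | 2 • s = 0} := by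
  obtain ⟨e, he⟩ := DivisionFieldRigidity.exists_torsionIso_two_of_divisionField_eq W W' hdiv
  exact finite_twoTorsion_relaxed_of_mazurMainConjecture_two_of_torsionIso W W' hper hmod hord ht hμan hMC hΔ e he

/-- **MC₂(W), `Δ_W < 0` ⟹ (A)₂^{rel ∞}(W′) for every model `W′` of every quadratic twist of `W`** (`C • W′ = W.quadraticTwist d`, `d ≠ 0`;
the twist may have ANY rank and ANY reduction at `2`). [cite: SilvermanAEC2009, X.5 Cor. 5.4] [cite: LimSujatha2018, §3 Prop. 3.2] -/
theorem finite_twoTorsion_relaxed_of_mazurMainConjecture_two_of_smul_eq_quadraticTwist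
    (hper : realPeriodRat_eq_unit_mul_plusPeriod_two) (hmod : nonempty_modularParametrizationData) (hord : IsOrdinaryAt W 2)
    (ht : ∀ x : ℚ, ¬ HasRationalTwoTorsionX W x)
    (hμan : ∀ ⦃N : ℕ⦄ [NeZero N] (f : CuspForm (Gamma0 N) 2), IsNewformOf W f →
      ∀ G : IwasawaAlgebra 2, IsEvenBranchLiftAtTwo W f G → red G ≠ 0)
    (hMC : MazurMainConjecture W 2) (hΔ : W.Δ < 0) {d : ℚ} (hd : d ≠ 0) {C : VariableChange ℚ} (hC : C • W' = W.quadraticTwist d) :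
    ∀ (κ : ZpExtension ℚ 2) (γ : absoluteGaloisGroup ℚ), κ.IsCyclotomic → κ.IsTopGenerator γ → IsCyclotomicVariable 2 γ →
      Set.Finite {s : W'.fineSelmerInftyRelaxedInf κ | 2 • s = 0} := by
  haveI : NeZero (2 : ℚ) := ⟨two_ne_zero⟩
  exact finite_twoTorsion_relaxed_of_mazurMainConjecture_two_of_divisionField_eq W W' hper hmod hord ht hμan hMC hΔ
    (QuadraticTwist.divisionField_two_of_smul_eq_quadraticTwist W W' hd hC).symm

/-- **MC₂(W), `Δ_W < 0` ⟹ (A)₂^{rel ∞}(W′) for every isogeny `W → W′` of odd degree** (att-p5 g6 `OddIsogeny`).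
[cite: SilvermanAEC2009, III.4] [cite: LimSujatha2018, §3 Prop. 3.2] -/
theorem finite_twoTorsion_relaxed_of_mazurMainConjecture_two_of_isogeny_of_odd_degree
    (hper : realPeriodRat_eq_unit_mul_plusPeriod_two) (hmod : nonempty_modularParametrizationData) (hord : IsOrdinaryAt W 2)
    (ht : ∀ x : ℚ, ¬ HasRationalTwoTorsionX W x)
    (hμan : ∀ ⦃N : ℕ⦄ [NeZero N] (f : CuspForm (Gamma0 N) 2), IsNewformOf W f →
      ∀ G : IwasawaAlgebra 2, IsEvenBranchLiftAtTwo W f G → red G ≠ 0)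
    (hMC : MazurMainConjecture W 2) (hΔ : W.Δ < 0) (φ : Isogeny W W') (hodd : Odd φ.degree) :
    ∀ (κ : ZpExtension ℚ 2) (γ : absoluteGaloisGroup ℚ), κ.IsCyclotomic → κ.IsTopGenerator γ → IsCyclotomicVariable 2 γ →
      Set.Finite {s : W'.fineSelmerInftyRelaxedInf κ | 2 • s = 0} := by
  obtain ⟨e, -, he⟩ := OddIsogeny.exists_torsionIso_two_of_isogeny_of_odd_degree two_ne_zero φ hodd
  exact finite_twoTorsion_relaxed_of_mazurMainConjecture_two_of_torsionIso W W' hper hmod hord ht hμan hMC hΔ e he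

/-- **MC₂(W), `Δ_W < 0` ⟹ (A)₂^{rel ∞}(W′) whenever the `2`-division cubics of `W` and `W′` have the same splitting field in `ℚ̄`**
(att-p5 g6 `DivisionCubic`). [cite: SilvermanAEC2009, VIII.§1] [cite: LimSujatha2018, §3 Prop. 3.2] -/
theorem finite_twoTorsion_relaxed_of_mazurMainConjecture_two_of_adjoin_rootSet_eq
    (hper : realPeriodRat_eq_unit_mul_plusPeriod_two) (hmod : nonempty_modularParametrizationData) (hord : IsOrdinaryAt W 2)
    (ht : ∀ x : ℚ, ¬ HasRationalTwoTorsionX W x)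
    (hμan : ∀ ⦃N : ℕ⦄ [NeZero N] (f : CuspForm (Gamma0 N) 2), IsNewformOf W f →
      ∀ G : IwasawaAlgebra 2, IsEvenBranchLiftAtTwo W f G → red G ≠ 0)
    (hMC : MazurMainConjecture W 2) (hΔ : W.Δ < 0)
    (hroots : IntermediateField.adjoin ℚ (W.twoTorsionPolynomial.toPoly.rootSet (AlgebraicClosure ℚ)) =
      IntermediateField.adjoin ℚ (W'.twoTorsionPolynomial.toPoly.rootSet (AlgebraicClosure ℚ))) :
    ∀ (κ : ZpExtension ℚ 2) (γ : absoluteGaloisGroup ℚ), κ.IsCyclotomic → κ.IsTopGenerator γ → IsCyclotomicVariable 2 γ →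
      Set.Finite {s : W'.fineSelmerInftyRelaxedInf κ | 2 • s = 0} :=
  finite_twoTorsion_relaxed_of_mazurMainConjecture_two_of_divisionField_eq W W' hper hmod hord ht hμan hMC hΔ
    (DivisionCubic.divisionField_two_eq_of_adjoin_rootSet_eq W W' hroots)

/-! ## §2 From the crux `MainConjectureOfRankZeroBSDAtTwo` by name, `Δ_W < 0` -/

/-- **The crux BY NAME, `Δ_W < 0` seed-cell curve `W` with BSD₂(W) ⟹ (A)₂^{rel ∞}(W′) for every `W′/ℚ` with `W[2] ≅ W′[2]`
equivariantly** (PRINT `hper`, `hmod`): C2 gives MC₂(W) on the cell, then §1. Conditional; BSD is not proved by any of this.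
[cite: GreenbergLNM1716, §1 Conj. 1.11 (p. 58)] [cite: LimSujatha2018, §3 Prop. 3.2] -/
theorem finite_twoTorsion_relaxed_of_mainConjectureOfRankZeroBSDAtTwo_of_torsionIso
    (hper : realPeriodRat_eq_unit_mul_plusPeriod_two) (hmod : nonempty_modularParametrizationData)
    (hC2 : MainConjectureOfRankZeroBSDAtTwo) (hcm : ¬ W.HasCM) (hord : IsOrdinaryAt W 2)
    (ht : ∀ x : ℚ, ¬ HasRationalTwoTorsionX W x) (hsq : ¬ IsSquare W.Δ) (hr : W.analyticRank = 0)
    (hμan : ∀ ⦃N : ℕ⦄ [NeZero N] (f : CuspForm (Gamma0 N) 2), IsNewformOf W f →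
      ∀ G : IwasawaAlgebra 2, IsEvenBranchLiftAtTwo W f G → red G ≠ 0)
    (hbsd : BSDp W 2) (hΔ : W.Δ < 0)
    (e : W.geomTorsion 2 ≃+ W'.geomTorsion 2) (he : ∀ (σ : absoluteGaloisGroup ℚ) (P : W.geomTorsion 2), e (σ • P) = σ • e P) :
    ∀ (κ : ZpExtension ℚ 2) (γ : absoluteGaloisGroup ℚ), κ.IsCyclotomic → κ.IsTopGenerator γ → IsCyclotomicVariable 2 γ →
      Set.Finite {s : W'.fineSelmerInftyRelaxedInf κ | 2 • s = 0} :=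
  finite_twoTorsion_relaxed_of_mazurMainConjecture_two_of_torsionIso W W' hper hmod hord ht hμan
    (hC2 W hcm hord ht hsq hr hμan hbsd) hΔ e he

/-- **The crux BY NAME ⟹ (A)₂^{rel ∞} for every model of every QUADRATIC TWIST of a `Δ < 0` seed-cell curve with BSD₂** (any rank,
any reduction at `2` of the twist). [cite: SilvermanAEC2009, X.5 Cor. 5.4] [cite: LimSujatha2018, §3 Prop. 3.2] -/
theorem finite_twoTorsion_relaxed_of_mainConjectureOfRankZeroBSDAtTwo_of_smul_eq_quadraticTwist
    (hper : realPeriodRat_eq_unit_mul_plusPeriod_two) (hmod : nonempty_modularParametrizationData)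
    (hC2 : MainConjectureOfRankZeroBSDAtTwo) (hcm : ¬ W.HasCM) (hord : IsOrdinaryAt W 2)
    (ht : ∀ x : ℚ, ¬ HasRationalTwoTorsionX W x) (hsq : ¬ IsSquare W.Δ) (hr : W.analyticRank = 0)
    (hμan : ∀ ⦃N : ℕ⦄ [NeZero N] (f : CuspForm (Gamma0 N) 2), IsNewformOf W f →
      ∀ G : IwasawaAlgebra 2, IsEvenBranchLiftAtTwo W f G → red G ≠ 0)
    (hbsd : BSDp W 2) (hΔ : W.Δ < 0) {d : ℚ} (hd : d ≠ 0) {C : VariableChange ℚ} (hC : C • W' = W.quadraticTwist d) :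
    ∀ (κ : ZpExtension ℚ 2) (γ : absoluteGaloisGroup ℚ), κ.IsCyclotomic → κ.IsTopGenerator γ → IsCyclotomicVariable 2 γ →
      Set.Finite {s : W'.fineSelmerInftyRelaxedInf κ | 2 • s = 0} :=
  finite_twoTorsion_relaxed_of_mazurMainConjecture_two_of_smul_eq_quadraticTwist W W' hper hmod hord ht hμan
    (hC2 W hcm hord ht hsq hr hμan hbsd) hΔ hd hC

/-- **The crux BY NAME ⟹ (A)₂^{rel ∞} for every curve ODD-ISOGENOUS to a `Δ < 0` seed-cell curve with BSD₂.**
[cite: SilvermanAEC2009, III.4] [cite: LimSujatha2018, §3 Prop. 3.2] -/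
theorem finite_twoTorsion_relaxed_of_mainConjectureOfRankZeroBSDAtTwo_of_isogeny_of_odd_degree
    (hper : realPeriodRat_eq_unit_mul_plusPeriod_two) (hmod : nonempty_modularParametrizationData)
    (hC2 : MainConjectureOfRankZeroBSDAtTwo) (hcm : ¬ W.HasCM) (hord : IsOrdinaryAt W 2)
    (ht : ∀ x : ℚ, ¬ HasRationalTwoTorsionX W x) (hsq : ¬ IsSquare W.Δ) (hr : W.analyticRank = 0)
    (hμan : ∀ ⦃N : ℕ⦄ [NeZero N] (f : CuspForm (Gamma0 N) 2), IsNewformOf W f →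
      ∀ G : IwasawaAlgebra 2, IsEvenBranchLiftAtTwo W f G → red G ≠ 0)
    (hbsd : BSDp W 2) (hΔ : W.Δ < 0) (φ : Isogeny W W') (hodd : Odd φ.degree) :
    ∀ (κ : ZpExtension ℚ 2) (γ : absoluteGaloisGroup ℚ), κ.IsCyclotomic → κ.IsTopGenerator γ → IsCyclotomicVariable 2 γ →
      Set.Finite {s : W'.fineSelmerInftyRelaxedInf κ | 2 • s = 0} :=
  finite_twoTorsion_relaxed_of_mazurMainConjecture_two_of_isogeny_of_odd_degree W W' hper hmod hord ht hμan
    (hC2 W hcm hord ht hsq hr hμan hbsd) hΔ φ hodd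

/-- **The crux BY NAME ⟹ (A)₂^{rel ∞} for every elliptic curve over `ℚ` whose `2`-division cubic has the same splitting field as
that of a `Δ < 0` seed-cell curve with BSD₂.** [cite: SilvermanAEC2009, VIII.§1] [cite: LimSujatha2018, §3 Prop. 3.2] -/
theorem finite_twoTorsion_relaxed_of_mainConjectureOfRankZeroBSDAtTwo_of_adjoin_rootSet_eq
    (hper : realPeriodRat_eq_unit_mul_plusPeriod_two) (hmod : nonempty_modularParametrizationData)
    (hC2 : MainConjectureOfRankZeroBSDAtTwo) (hcm : ¬ W.HasCM) (hord : IsOrdinaryAt W 2)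
    (ht : ∀ x : ℚ, ¬ HasRationalTwoTorsionX W x) (hsq : ¬ IsSquare W.Δ) (hr : W.analyticRank = 0)
    (hμan : ∀ ⦃N : ℕ⦄ [NeZero N] (f : CuspForm (Gamma0 N) 2), IsNewformOf W f →
      ∀ G : IwasawaAlgebra 2, IsEvenBranchLiftAtTwo W f G → red G ≠ 0)
    (hbsd : BSDp W 2) (hΔ : W.Δ < 0)
    (hroots : IntermediateField.adjoin ℚ (W.twoTorsionPolynomial.toPoly.rootSet (AlgebraicClosure ℚ)) =
      IntermediateField.adjoin ℚ (W'.twoTorsionPolynomial.toPoly.rootSet (AlgebraicClosure ℚ))) :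
    ∀ (κ : ZpExtension ℚ 2) (γ : absoluteGaloisGroup ℚ), κ.IsCyclotomic → κ.IsTopGenerator γ → IsCyclotomicVariable 2 γ →
      Set.Finite {s : W'.fineSelmerInftyRelaxedInf κ | 2 • s = 0} :=
  finite_twoTorsion_relaxed_of_mazurMainConjecture_two_of_adjoin_rootSet_eq W W' hper hmod hord ht hμan
    (hC2 W hcm hord ht hsq hr hμan hbsd) hΔ hroots

end Summit.BirchSwinnertonDyer.BirchSwinnertonDyer.Theorems.AlignedTransportAtTwoFineRoad.NecessitySpread

end
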